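import Literature.Computability.AlgebraicComplexity.Hyperdeterminant
import Literature.Computability.AlgebraicComplexity.MignonRessayreBound
import Summits.ValiantsHypothesis.ValiantsHypothesis.Theorems.DetQPDetqpThesisStubDcPerPolyLeDcHyperdet
import Summits.ValiantsHypothesis.ValiantsHypothesis.Theorems.DetQPDetqpThesisStubHess0HyperdetEqSum
import Summits.ValiantsHypothesis.ValiantsHypothesis.Theorems.DetQPDetqpThesisStubHdBlockEmbSumEq
import Summits.ValiantsHypothesis.ValiantsHypothesis.Theorems.DetQPDetqpThesisStubHdPatternMulVecInjective

/-!
# Crux `DetQP.DetqpThesis` (stmt-ValiantsHypothesis-0315), line `Sketch` (idea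
# `four-dimensional-determinant`) — the Mignon–Ressayre floor for Cayley's four-dimensional
# hyperdeterminant: `n⁴ ≤ 2 · dc(HD_n)` for `n ≥ 3`

The line transfers the crux (the Extended Valiant Hypothesis in dc form) to the generic
four-dimensional combinatorial hyperdeterminant `HD_n := hyperdet (fun I : Fin 4 → Fin n => X I)`
(`Literature.Computability.AlgebraicComplexity.hyperdet`).  Its one remaining stub
`stub_hyperdet_not_qp` (`dc(HD_n)` not quasi-polynomially bounded) is crux-equivalent; this file
lands the card's "first non-bookkeeping lemma" toward it — the determinantal hypersurface method of
Mignon–Ressayre applied to `Z(HD_n)`: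

* `hess0_hyperdet_blockEmb` — COVARIANCE IDENTITY (any `n`, any matrix point `Y`): at the diagonal
  block embedding `blockEmb Y : K ↦ [K 2 = K 0][K 3 = K 1] · Y (K 0, K 1)` the Hessian of `HD_n` is
  `Hess(HD_n)(blockEmb Y)[I, J] = n! · ε(I, J) · Hess(per_n)(Y)[(I 0, I 1), (J 0, J 1)]` with
  `ε(I, J) ∈ {0, ±1}` testing that slots `2, 3` of `I, J` are diagonal-or-swapped (assembled from the
  landed stubs T1a `stub_hess0_hyperdet_eq_sum` and T1b `stub_hdBlockEmb_sum_eq`);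
* `hess0_hyperdet_blockEmb_mrPoint`, `rank_hess0_hyperdet_blockEmb_mrPoint` — at the block-embedded
  Mignon–Ressayre point `y₀` of `{per_{m+3} = 0}` this Hessian is `((m+3)! · m!) •` an explicit
  pattern matrix of FULL rank `(m+3)⁴` (stub T2 `stub_hdPattern_mulVec_injective`; its
  diagonal/diagonal block is Mignon–Ressayre's `mrHess`);
* `eval_blockEmb_mrPoint_hyperdet` — the point lies on the hypersurface:
  `HD(blockEmb y₀) = (m+3)! · per(y₀) = 0` (`hyperdet_blockArr`, `eval_mrPoint_perPoly`);
* `pow_four_le_two_mul_of_hasDetRepr_hyperdet`, `pow_four_le_two_mul_determinantalComplexity_hyperdet`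
  — hence, by the rank bound `rank_hess0_det_le` (Mignon–Ressayre 2004 §2–3, in tree),
  **`n⁴ ≤ 2 · dc(HD_n)` for every `n ≥ 3`** over `ℂ`; numerically `dc(HD_3) ≥ 41`, `dc(HD_4) ≥ 128`
  (`fortyone_le_determinantalComplexity_hyperdet_three`, `…_four`).

In the number of variables `N = n⁴` this is the same `N / 2` floor that Mignon–Ressayre give for
`per` and `det` (`N = n²`): at second order the hyperdeterminant hypersurface is as non-degenerate
as it can be, so every Hessian-rank engine saturates on `HD` exactly where it saturates on `per` —
the calibration the idea card asked for (kit j013681 had it for `n ≤ 4` at random points; here it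
is a theorem for all `n`, at a structured point).
-/

noncomputable section

-- single-conjunct layout: Sub = Summit, duplicated namespace component intended
set_option linter.dupNamespace false

namespace Summit.ValiantsHypothesis.ValiantsHypothesis.Theorems.DetQPDetqpThesis

open Literature.Computability.AlgebraicComplexity MvPolynomial

/-- **Covariance of the Hessian under the diagonal block embedding** (any `n`, any point `Y` of
matrix space): the Hessian of `HD_n` at `blockEmb Y` has entry `(I, J)` equal to
`n! · ε(I, J) · Hess(per_n)(Y)[(I 0, I 1), (J 0, J 1)]`, `ε(I,J) = ε₂ ε₃` with `ε₂ = +1` if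
`I 2 = I 0 ∧ J 2 = J 0`, `-1` if `I 2 = J 0 ∧ J 2 = I 0`, `0` otherwise (likewise `ε₃` on slots
`3 / 1`).  T1a (`stub_hess0_hyperdet_eq_sum`, Leibniz) followed by T1b (`stub_hdBlockEmb_sum_eq`,
the permutation combinatorics). -/
theorem hess0_hyperdet_blockEmb (n : ℕ) (Y : Fin n × Fin n → ℂ) (I J : Fin 4 → Fin n) :
    hess0 (transl (fun K : Fin 4 → Fin n => if K 2 = K 0 ∧ K 3 = K 1 then Y (K 0, K 1) else 0)
      (hyperdet (fun I : Fin 4 → Fin n => (X I : MvPolynomial (Fin 4 → Fin n) ℂ)))) I J =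
    (n.factorial : ℂ) *
      (if ((I 2 = I 0 ∧ J 2 = J 0) ∨ (I 2 = J 0 ∧ J 2 = I 0)) ∧
          ((I 3 = I 1 ∧ J 3 = J 1) ∨ (I 3 = J 1 ∧ J 3 = I 1))
        then (if I 2 = I 0 then 1 else -1) * (if I 3 = I 1 then 1 else -1) else 0) *
      hess0 (transl Y (perPoly (Fin n) ℂ)) (I 0, I 1) (J 0, J 1) := by
  rw [stub_hess0_hyperdet_eq_sum, stub_hdBlockEmb_sum_eq]

/-- The Hessian of `HD_{m+3}` at the block-embedded Mignon–Ressayre point `y₀` is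
`((m+3)! · m!) •` the hyperdeterminantal pattern matrix `ε(I,J) · mrHess (I 0, I 1) (J 0, J 1)`
(`hess0_hyperdet_blockEmb` at `Y = y₀` and `hess0_transl_mrPoint_perPoly`). -/
theorem hess0_hyperdet_blockEmb_mrPoint (m : ℕ) :
    hess0 (transl (fun K : Fin 4 → Fin (m + 3) =>
        if K 2 = K 0 ∧ K 3 = K 1 then mrPoint ℂ m (K 0, K 1) else 0)
      (hyperdet (fun I : Fin 4 → Fin (m + 3) => (X I : MvPolynomial (Fin 4 → Fin (m + 3)) ℂ)))) =
    (((m + 3).factorial * m.factorial : ℕ) : ℂ) • (Matrix.of fun I J : Fin 4 → Fin (m + 3) =>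
      (if ((I 2 = I 0 ∧ J 2 = J 0) ∨ (I 2 = J 0 ∧ J 2 = I 0)) ∧
          ((I 3 = I 1 ∧ J 3 = J 1) ∨ (I 3 = J 1 ∧ J 3 = I 1))
        then (if I 2 = I 0 then (1 : ℂ) else -1) * (if I 3 = I 1 then 1 else -1) else 0) *
      mrHess ℂ m (I 0, I 1) (J 0, J 1)) := by
  ext I J
  rw [hess0_hyperdet_blockEmb, hess0_transl_mrPoint_perPoly]
  simp only [Matrix.smul_apply, Matrix.of_apply, smul_eq_mul, Nat.cast_mul]
  ring

/-- Hence that Hessian has **full rank `(m+3)⁴`** (T2 `stub_hdPattern_mulVec_injective`,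
`rank_smul_eq`). -/
theorem rank_hess0_hyperdet_blockEmb_mrPoint (m : ℕ) :
    (hess0 (transl (fun K : Fin 4 → Fin (m + 3) =>
        if K 2 = K 0 ∧ K 3 = K 1 then mrPoint ℂ m (K 0, K 1) else 0)
      (hyperdet (fun I : Fin 4 → Fin (m + 3) =>
        (X I : MvPolynomial (Fin 4 → Fin (m + 3)) ℂ))))).rank = (m + 3) ^ 4 := by
  rw [hess0_hyperdet_blockEmb_mrPoint, rank_smul_eq]
  · rw [Matrix.rank_of_isUnit _
      (Matrix.mulVec_injective_iff_isUnit.mp (stub_hdPattern_mulVec_injective m)),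
      Fintype.card_fun, Fintype.card_fin, Fintype.card_fin]
  · exact_mod_cast Nat.mul_ne_zero (Nat.factorial_ne_zero _) (Nat.factorial_ne_zero _)

/-- `HD_{m+3}` **vanishes at the block-embedded Mignon–Ressayre point**:
`HD(blockEmb y₀) = (m+3)! · per(y₀) = 0` (`map_hyperdet`, `hyperdet_blockArr`,
`eval_mrPoint_perPoly`). -/
theorem eval_blockEmb_mrPoint_hyperdet (m : ℕ) :
    eval (fun K : Fin 4 → Fin (m + 3) => if K 2 = K 0 ∧ K 3 = K 1 then mrPoint ℂ m (K 0, K 1) else 0)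
      (hyperdet (fun I : Fin 4 → Fin (m + 3) => (X I : MvPolynomial (Fin 4 → Fin (m + 3)) ℂ))) = 0 := by
  rw [map_hyperdet]
  simp only [eval_X]
  have hM : (fun K : Fin 4 → Fin (m + 3) => if K 2 = K 0 ∧ K 3 = K 1 then mrPoint ℂ m (K 0, K 1) else 0)
      = fun K : Fin 4 → Fin (m + 3) => if K 2 = K 0 ∧ K 3 = K 1
          then (Matrix.of fun a b : Fin (m + 3) => mrPoint ℂ m (a, b)) (K 0) (K 1) else 0 := by
    simp only [Matrix.of_apply]
  rw [hM, hyperdet_blockArr, ← eval_perPoly, eval_mrPoint_perPoly, mul_zero]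

/-- **Mignon–Ressayre floor for the four-dimensional hyperdeterminant, core inequality**: if
`HD_{m+3} = det A` with `A` an `M × M` matrix of affine linear forms over `ℂ`, then
`(m+3)⁴ ≤ 2M`.  Proof: translate to `blockEmb y₀ ∈ Z(HD)`; the Hessian of
`det A(X + x₀) = HD(X + x₀)` at `0` has rank `≤ 2M` (`rank_hess0_det_le`) and rank `(m+3)⁴`
(`rank_hess0_hyperdet_blockEmb_mrPoint`). -/
theorem pow_four_le_two_mul_of_hasDetRepr_hyperdet {m M : ℕ}
    (h : HasDetRepr (hyperdet (fun I : Fin 4 → Fin (m + 3) =>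
      (X I : MvPolynomial (Fin 4 → Fin (m + 3)) ℂ))) M) : (m + 3) ^ 4 ≤ 2 * M := by
  obtain ⟨A, hA, hdet⟩ := h
  set x₀ : (Fin 4 → Fin (m + 3)) → ℂ := fun K =>
    if K 2 = K 0 ∧ K 3 = K 1 then mrPoint ℂ m (K 0, K 1) else 0 with hx₀
  set A' : Matrix (Fin M) (Fin M) (MvPolynomial (Fin 4 → Fin (m + 3)) ℂ) :=
    (transl x₀).mapMatrix A with hA'
  have hA'deg : ∀ i j, (A' i j).totalDegree ≤ 1 := fun i j =>
    (totalDegree_transl_le _ _).trans (hA i j)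
  have hA'det : A'.det = transl x₀ (hyperdet (fun I : Fin 4 → Fin (m + 3) =>
      (X I : MvPolynomial (Fin 4 → Fin (m + 3)) ℂ))) := by
    rw [hA', ← AlgHom.map_det, hdet]
  have h0 : constantCoeff A'.det = 0 := by
    rw [hA'det, constantCoeff_transl, hx₀, eval_blockEmb_mrPoint_hyperdet]
  have hrank := rank_hess0_det_le A' hA'deg h0
  rwa [hA'det, hx₀, rank_hess0_hyperdet_blockEmb_mrPoint] at hrank

/-- **`n⁴ ≤ 2 · dc(HD_n)` for `n ≥ 3`** over `ℂ`: the determinantal complexity of the generic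
four-dimensional Cayley hyperdeterminant is at least half its number of variables (the infimum
`dc` is attained, `hasDetRepr_determinantalComplexity_holds`, by Valiant universality). -/
theorem pow_four_le_two_mul_determinantalComplexity_hyperdet {n : ℕ} (hn : 3 ≤ n) :
    n ^ 4 ≤ 2 * determinantalComplexity
      (hyperdet (fun I : Fin 4 → Fin n => (X I : MvPolynomial (Fin 4 → Fin n) ℂ))) := by
  obtain ⟨m, rfl⟩ : ∃ m, n = m + 3 := ⟨n - 3, by omega⟩
  exact pow_four_le_two_mul_of_hasDetRepr_hyperdet (hasDetRepr_determinantalComplexity_holds _)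

/-- Numerically: `dc(HD_3) ≥ 41` (`81 ≤ 2 · dc`). -/
theorem fortyone_le_determinantalComplexity_hyperdet_three :
    41 ≤ determinantalComplexity
      (hyperdet (fun I : Fin 4 → Fin 3 => (X I : MvPolynomial (Fin 4 → Fin 3) ℂ))) := by
  have h := pow_four_le_two_mul_determinantalComplexity_hyperdet (n := 3) le_rfl
  omega

/-- Numerically: `dc(HD_4) ≥ 128` (`256 ≤ 2 · dc`). -/
theorem onetwentyeight_le_determinantalComplexity_hyperdet_four :
    128 ≤ determinantalComplexity
      (hyperdet (fun I : Fin 4 → Fin 4 => (X I : MvPolynomial (Fin 4 → Fin 4) ℂ))) := by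
  have h := pow_four_le_two_mul_determinantalComplexity_hyperdet (n := 4) (by norm_num)
  omega

end Summit.ValiantsHypothesis.ValiantsHypothesis.Theorems.DetQPDetqpThesis

end
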